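import Literature.AlgebraicGeometry.AbelianSchemes.PoincareFamilyKSClasses
import Literature.AlgebraicGeometry.AbelianSchemes.PoincareFamilyKSAssembly
import Literature.AlgebraicGeometry.AbelianSchemes.PoincareFamilySquare
import Literature.AlgebraicGeometry.AbelianSchemes.PoincareFamilyPointsInjective
import Literature.AlgebraicGeometry.AbelianSchemes.AbelianSchemeRelDimOfConnected
import Literature.AlgebraicGeometry.AbelianSchemes.InfinitesimalPointDifferenceClassShifts
import Literature.AlgebraicGeometry.AbelianSchemes.AbelianSchemeSmallExtensionIdealCohomologyDimension
import Literature.AlgebraicGeometry.Morphisms.ArtinianLiftsOfSmoothEtale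
import Literature.AlgebraicGeometry.Dimension.SmoothRelativeDimensionChart
import Literature.AlgebraicGeometry.Deformation.MorphismLiftsSquareZeroTorsorParametrisation
import Mathlib.AlgebraicGeometry.Morphisms.Etale
import Mathlib.RingTheory.LocalRing.ResidueField.Basic
import HarnessLib

/-!
# Kodaira–Spencer SURJECTIVITY of the Poincaré family at the level of lifts — the letter S-e of the (Mc) N3′ tower
# (Mumford, *Abelian Varieties* §13, proof of the Theorem pp. 126–127: «both have dimension `g`, so we can alter the lifting»)

Layer `Literature/AlgebraicGeometry/AbelianSchemes`, namespace `Literature.AlgebraicGeometry.AbelianSchemes.AbelianSchemeOver`.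
THEOREMS ONLY (no definition, no named fact, no instance, no notation, no `sorry`).

For an abelian scheme `A′/S′` (affine base), a homomorphism `π : A′ → Â` which is finite étale surjective with kernel `K(L′)` on points,
a rank-one `𝒫` on `A′ × Â` rigidified along `ε × 1` with `(1 × π)^*𝒫 ≅ Λ(L′)`, and a principal small extension `q : C′ ↠ C`
(`ker q = (t₀)`, `t₀𝔪 = 0`) of Artinian local rings over `S′` with the thickening `i = 1 × Spec q : A′_C ↪ A′_{C′}` (ideal `𝓘`):
for every lift `g₁ : Spec C′ → Â` and every `t ∈ H¹(A′_{C′}, 𝓘)` there is a lift `g₂` of the same `C`-point with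
`[(1 × g₂)^*𝒫] = [(1 × g₁)^*𝒫] + H¹(truncExp)(t)`.

ASSEMBLY of tree bricks: the count ★ `exists_lift_detClassH_eq_add_of_count` and the kernel clause ★
`comp_eq_one_of_detClassH_mumford_eq_zero` (`PoincareFamilyKSAssembly`), the square for `𝒫` ★ `PoincareFamilySquare`, the rigidification
★ `PoincareFamilyPointsInjective` §5, étale uniqueness of nilpotent lifts ★ `ArtinianLiftsOfSmoothEtale`, the classes of infinitesimal
points ★ `PoincareFamilyKSClasses`, the parametrisation of infinitesimal points by `κ^g` ★ `MorphismLiftsSquareZeroTorsorParametrisation`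
on a chart of relative dimension `g` ★ `SmoothRelativeDimensionChart`, additivity ∕ homogeneity of the class shifts ★
`InfinitesimalPointDifferenceClassShifts`, and the target space `H¹(𝓘) ≃ κ^g` with scalars ★ `AbelianSchemeSmallExtensionIdealCohomologyDimension`.

* `sheafH_idealSheafAb_eq_zero_of_isIso` — `Hⁿ(𝓘) = 0` for a trivial thickening (the case `t₀ = 0`).
* `exists_lift_detClassH_eq_add_of_panels` — generic glue: square + étale uniqueness + parametrisation + cocycle laws ⊢ S-e.
* `exists_lift_detClassH_eq_add_of_principal` — S-e for any `A′/S′` over an affine locally Noetherian base, `t₀ ≠ 0`.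
* **`exists_lift_detClassH_eq_add_smallExtension`** — the letter S-e of `Cruxes/HDel/Lines/F3DualAbelianSchemeMcN3.lean` VERBATIM
  (`A′ = A.baseChange p` for `p : S′ → Spec R` finite étale surjective).

Cell `hodgecm-mathlib` (FLOOR 0), P1 (Mc) N3′ letter S-e (closer); author F0P1c-p01 (g0).  PROOF lane.
HC_CM is proved only modulo the 7 printed citations until rung 0 closes; nothing here is about HC.

## References
* [MumfordAV1970] D. Mumford, *Abelian Varieties* (1970), §13, proof of the Theorem (pp. 125–130).
* [Hartshorne2010] R. Hartshorne, *Deformation Theory*, GTM 257 (2010), §6 Thm. 6.4 (b) (pp. 50–51).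
* [StacksProject] The Stacks Project, Tag 08KY (first-order thickenings), Tag 02H6.
* [GortzWedhorn2020] U. Görtz, T. Wedhorn, *Algebraic Geometry I*, 2nd ed. (2020), Def. 6.14, Prop. 6.15 (1).
-/

set_option autoImplicit false

noncomputable section

-- `TopCat.Presheaf`/`Scheme.Modules` are not reducible (as in ★ `AbelianSchemeKOfL`).
set_option backward.isDefEq.respectTransparency false

universe u

open CategoryTheory CategoryTheory.Limits AlgebraicGeometry MonoidalCategory CartesianMonoidalCategory Opposite TopologicalSpace
open scoped MonObj

/-! ## K5 — the letter S-e, assembled -/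

namespace Literature.AlgebraicGeometry.AbelianSchemes

open Literature.AlgebraicGeometry.Motives Literature.AlgebraicGeometry.Modules Literature.AlgebraicGeometry.Deformation
open Literature.AlgebraicGeometry.Morphisms IsLocalRing

namespace AbelianSchemeOver

/-- `Hⁿ(X′, 𝓘) = 0` for the TRIVIAL thickening (`i` an isomorphism: every section of `𝓘 = ker i♯` vanishes, so `𝟙_𝓘 = 0`).
[cite: StacksProject, Tag 08KY] -/
theorem sheafH_idealSheafAb_eq_zero_of_isIso {X X' : Scheme.{u}} (i : X ⟶ X') [IsIso i] (n : ℕ)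
    (t : (idealSheafAb i).H n) : t = 0 := by
  have hid : 𝟙 (idealSheafAb i) = 0 := by
    apply Sheaf.hom_ext
    ext U y
    change (𝟙 (idealSheafAb i) : idealSheafAb i ⟶ idealSheafAb i).hom.app U y = (0 : idealSheafAb i ⟶ idealSheafAb i).hom.app U y
    have hy : y = 0 := by
      apply idealVal_injective i U.unop
      rw [idealVal_zero]
      have h0 := app_idealVal i U.unop y
      have hinj : Function.Injective (i.app U.unop) := (ConcreteCategory.bijective_of_isIso (i.app U.unop)).1
      exact hinj (h0.trans (map_zero _).symm)
    rw [hy, map_zero, map_zero]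
  rw [← Sheaf.H.map_id_apply t, hid, Sheaf.H.map_apply, Abelian.Ext.mk₀_zero, Abelian.Ext.comp_zero]

/-- **S-e from the PANELS (generic glue).**  For an abelian scheme `A/S` with `π : A → Â`, `𝒫` on `A × Â`, a first-order thickening
`1 × ι₀ : A_{T₀} → A_T`, the square for `𝒫` (`hsq`), étale uniqueness of infinitesimal lifts through `π` (`huniq`), a cocycle `c` presenting
`[Λ(L)]`, an injective-at-`1` parametrisation `pt : κ^g → A(T)` of infinitesimal points, an additive identification `E : H¹(𝓘) ≃ κ^g`, and the
two cocycle-level laws «classes of the pairs `(1 × 1, 1 × pt v)` are additive in `v`» (`hadd3`) and «`E` of them is `κ`-homogeneous in `v`»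
(`hhom3`): every `t ∈ H¹(𝓘)` is realised by moving any lift `g₁`.  (K1 + K2 + B-p07's count #3 §4.)
[cite: MumfordAV1970, §13 (proof of the Theorem, pp. 125–130)] [cite: Hartshorne2010, §6 Thm. 6.4 (b) (pp. 50–51)] -/
theorem exists_lift_detClassH_eq_add_of_panels {S : Scheme.{0}} (A hat : AbelianSchemeOver S) (π : A.X ⟶ hat.X) [IsMonHom π]
    {L : A.left.Modules} (hL : HasRank L 1)
    (hε : CechPic.pullback A.unitSection (detClass (HasRank.isFiniteLocallyFree' hL)) = 1)
    (P : (A.prodLeft hat).Modules) (h1 : HasRank P 1)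
    (hker : ∀ (T : Over S) (u : T ⟶ A.X), u ≫ π = 1 ↔ A.MemKOfL L u)
    (hsock : Nonempty ((Scheme.Modules.pullback (A.X ◁ π).left).obj P ≅ A.mumfordBundle L))
    {T₀ T : Over S} (ι₀ : T₀ ⟶ T) [IsFirstOrderThickening (A.X ◁ ι₀).left]
    (hsq : ∀ y₁ y₂ : T ⟶ hat.X,
      CechPic.pullback (A.X ◁ (y₁ * y₂)).left (detClass (HasRank.isFiniteLocallyFree' h1)) =
        CechPic.pullback (A.X ◁ y₁).left (detClass (HasRank.isFiniteLocallyFree' h1)) *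
          CechPic.pullback (A.X ◁ y₂).left (detClass (HasRank.isFiniteLocallyFree' h1)))
    (huniq : ∀ k : T ⟶ A.X, ι₀ ≫ k = 1 → k ≫ π = 1 → k = 1)
    {K : Type} [Field K] {g : ℕ} (E : (idealSheafAb (A.X ◁ ι₀).left).H 1 ≃+ (Fin g → K))
    {C' : Type} (res : C' → K) (hres : Function.Surjective res)
    (pt : (Fin g → K) → (T ⟶ A.X)) (hpt : ∀ v, ι₀ ≫ pt v = 1) (hpt1 : ∀ v, pt v = 1 → v = 0)
    (c : UnitCocycle (A.X ⊗ A.X).left) (hc : CechPic.mk c = A.mumfordClass (detClass (HasRank.isFiniteLocallyFree' hL)))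
    (hadd3 : ∀ (v w : Fin g → K)
      (x₁ : cechOneCocycles (idealSheafAb (A.X ◁ ι₀).left)
        (UnitCocycle.mul (UnitCocycle.pullback (A.X ◁ pt v).left c) (UnitCocycle.inv (UnitCocycle.pullback (A.X ◁ (1 : T ⟶ A.X)).left c))).U)
      (x₂ : cechOneCocycles (idealSheafAb (A.X ◁ ι₀).left)
        (UnitCocycle.mul (UnitCocycle.pullback (A.X ◁ pt w).left c) (UnitCocycle.inv (UnitCocycle.pullback (A.X ◁ (1 : T ⟶ A.X)).left c))).U)
      (x₃ : cechOneCocycles (idealSheafAb (A.X ◁ ι₀).left)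
        (UnitCocycle.mul (UnitCocycle.pullback (A.X ◁ pt (v + w)).left c) (UnitCocycle.inv (UnitCocycle.pullback (A.X ◁ (1 : T ⟶ A.X)).left c))).U),
      (∀ a b, idealVal (A.X ◁ ι₀).left _ ((x₁ : CechOneCochain (idealSheafAb (A.X ◁ ι₀).left) _) a b) =
        (UnitCocycle.mul (UnitCocycle.pullback (A.X ◁ pt v).left c) (UnitCocycle.inv (UnitCocycle.pullback (A.X ◁ (1 : T ⟶ A.X)).left c))).g
          a b _ inf_le_left inf_le_right - 1) →
      (∀ a b, idealVal (A.X ◁ ι₀).left _ ((x₂ : CechOneCochain (idealSheafAb (A.X ◁ ι₀).left) _) a b) =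
        (UnitCocycle.mul (UnitCocycle.pullback (A.X ◁ pt w).left c) (UnitCocycle.inv (UnitCocycle.pullback (A.X ◁ (1 : T ⟶ A.X)).left c))).g
          a b _ inf_le_left inf_le_right - 1) →
      (∀ a b, idealVal (A.X ◁ ι₀).left _ ((x₃ : CechOneCochain (idealSheafAb (A.X ◁ ι₀).left) _) a b) =
        (UnitCocycle.mul (UnitCocycle.pullback (A.X ◁ pt (v + w)).left c) (UnitCocycle.inv (UnitCocycle.pullback (A.X ◁ (1 : T ⟶ A.X)).left c))).g
          a b _ inf_le_left inf_le_right - 1) →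
      cechToH (idealSheafAb (A.X ◁ ι₀).left) _
          (UnitCocycle.mul (UnitCocycle.pullback (A.X ◁ pt (v + w)).left c) (UnitCocycle.inv (UnitCocycle.pullback (A.X ◁ (1 : T ⟶ A.X)).left c))).iSup_U_eq_top x₃ =
        cechToH (idealSheafAb (A.X ◁ ι₀).left) _
          (UnitCocycle.mul (UnitCocycle.pullback (A.X ◁ pt v).left c) (UnitCocycle.inv (UnitCocycle.pullback (A.X ◁ (1 : T ⟶ A.X)).left c))).iSup_U_eq_top x₁ +
        cechToH (idealSheafAb (A.X ◁ ι₀).left) _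
          (UnitCocycle.mul (UnitCocycle.pullback (A.X ◁ pt w).left c) (UnitCocycle.inv (UnitCocycle.pullback (A.X ◁ (1 : T ⟶ A.X)).left c))).iSup_U_eq_top x₂)
    (hhom3 : ∀ (a : C') (v : Fin g → K)
      (x₁ : cechOneCocycles (idealSheafAb (A.X ◁ ι₀).left)
        (UnitCocycle.mul (UnitCocycle.pullback (A.X ◁ pt v).left c) (UnitCocycle.inv (UnitCocycle.pullback (A.X ◁ (1 : T ⟶ A.X)).left c))).U)
      (x₂ : cechOneCocycles (idealSheafAb (A.X ◁ ι₀).left)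
        (UnitCocycle.mul (UnitCocycle.pullback (A.X ◁ pt (res a • v)).left c) (UnitCocycle.inv (UnitCocycle.pullback (A.X ◁ (1 : T ⟶ A.X)).left c))).U),
      (∀ a' b, idealVal (A.X ◁ ι₀).left _ ((x₁ : CechOneCochain (idealSheafAb (A.X ◁ ι₀).left) _) a' b) =
        (UnitCocycle.mul (UnitCocycle.pullback (A.X ◁ pt v).left c) (UnitCocycle.inv (UnitCocycle.pullback (A.X ◁ (1 : T ⟶ A.X)).left c))).g
          a' b _ inf_le_left inf_le_right - 1) →
      (∀ a' b, idealVal (A.X ◁ ι₀).left _ ((x₂ : CechOneCochain (idealSheafAb (A.X ◁ ι₀).left) _) a' b) =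
        (UnitCocycle.mul (UnitCocycle.pullback (A.X ◁ pt (res a • v)).left c) (UnitCocycle.inv (UnitCocycle.pullback (A.X ◁ (1 : T ⟶ A.X)).left c))).g
          a' b _ inf_le_left inf_le_right - 1) →
      E (cechToH (idealSheafAb (A.X ◁ ι₀).left) _
          (UnitCocycle.mul (UnitCocycle.pullback (A.X ◁ pt (res a • v)).left c) (UnitCocycle.inv (UnitCocycle.pullback (A.X ◁ (1 : T ⟶ A.X)).left c))).iSup_U_eq_top x₂) =
        res a • E (cechToH (idealSheafAb (A.X ◁ ι₀).left) _
          (UnitCocycle.mul (UnitCocycle.pullback (A.X ◁ pt v).left c) (UnitCocycle.inv (UnitCocycle.pullback (A.X ◁ (1 : T ⟶ A.X)).left c))).iSup_U_eq_top x₁))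
    (g₁ : T ⟶ hat.X) (t : (idealSheafAb (A.X ◁ ι₀).left).H 1) :
    ∃ g₂ : T ⟶ hat.X, ι₀ ≫ g₂ = ι₀ ≫ g₁ ∧
      detClassH (HasRank.isFiniteLocallyFree' (hasRank_pullback _ h1 :
          HasRank (X := (A.X ⊗ T).left) ((Scheme.Modules.pullback (A.baseChangeToProd hat T.hom g₂.left (Over.w g₂))).obj P) 1)) =
        detClassH (HasRank.isFiniteLocallyFree' (hasRank_pullback _ h1 :
          HasRank (X := (A.X ⊗ T).left) ((Scheme.Modules.pullback (A.baseChangeToProd hat T.hom g₁.left (Over.w g₁))).obj P) 1)) +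
          Sheaf.H.map (truncExp (A.X ◁ ι₀).left) 1 t := by
  -- K2: the `𝓘`-cocycles of the infinitesimal points and their classes
  have K2 := fun v => A.exists_cocycle_detClassH_pullback_whiskerLeft_mumfordBundle_eq hL hε ι₀ c hc (pt v) (hpt v)
  choose x hx hcls using K2
  let cls := fun v : Fin g → K =>
    cechToH (idealSheafAb (A.X ◁ ι₀).left) _
      (UnitCocycle.mul (UnitCocycle.pullback (A.X ◁ pt v).left c)
        (UnitCocycle.inv (UnitCocycle.pullback (A.X ◁ (1 : T ⟶ A.X)).left c))).iSup_U_eq_top (x v)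
  have hadd : ∀ v w : Fin g → K, cls (v + w) = cls v + cls w := fun v w =>
    hadd3 v w (x v) (x w) (x (v + w)) (hx v) (hx w) (hx (v + w))
  have hsmul : ∀ (a : K) (v : Fin g → K), E (cls (a • v)) = a • E (cls v) := fun a v => by
    obtain ⟨a, rfl⟩ := hres a
    exact hhom3 a v (x v) (x (res a • v)) (hx v) (hx (res a • v))
  -- K1: injectivity (kernel clause + étale uniqueness + injectivity of the parametrisation at `1`)
  have hinj : ∀ v : Fin g → K, cls v = 0 → v = 0 := fun v hv => by
    have h0 : detClassH (HasRank.isFiniteLocallyFree' (hasRank_pullback (A.X ◁ pt v).left (A.hasRank_mumfordBundle hL))) = 0 :=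
      (hcls v).trans ((congrArg (Sheaf.H.map (truncExp (A.X ◁ ι₀).left) 1) hv).trans (map_zero _))
    exact hpt1 v (huniq (pt v) (hpt v) (A.comp_eq_one_of_detClassH_mumford_eq_zero hat π hL hker (pt v) h0))
  exact A.exists_lift_detClassH_eq_add_of_count hat π hL P h1 hsock ι₀ hsq E rfl pt hpt cls hcls hadd hsmul hinj g₁ t

-- heavy `Over`/Čech unification: elaborates at ≈170k heartbeats under the current imports (probe 2026-08-30:
-- 160k ✗ ∕ 180k ✓); budgeted ×2 per the ops-buildfix standing ask (young-accept heartbeat cliffs).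
set_option maxHeartbeats 400000 in
/-- **S-e for ANY abelian scheme `A′/S′` (affine locally Noetherian base), principal small extension with `t₀ ≠ 0`** — the glue of
`exists_lift_detClassH_eq_add_of_panels` with the chart of relative dimension `g`, the parametrisation panel (p04), the locality∕linearity
panel (p03) and étale uniqueness (J1); the target-space identification `E` (p05's panel) and the relative dimension `g` of the closed fibre are
taken as data. [cite: MumfordAV1970, §13 (proof of the Theorem, pp. 125–130)] [cite: Hartshorne2010, §6 Thm. 6.4 (b) (pp. 50–51)] -/
theorem exists_lift_detClassH_eq_add_of_principal {S' : Scheme.{0}} [IsAffine S'] [IsLocallyNoetherian S']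
    (A' hat : AbelianSchemeOver S') (π : A'.X ⟶ hat.X) [IsMonHom π] [Etale π.left] [IsAffineHom π.left] [Surjective π.left]
    {L' : A'.left.Modules} (hL' : HasRank L' 1)
    (hε' : CechPic.pullback A'.unitSection (detClass (HasRank.isFiniteLocallyFree' hL')) = 1)
    (P : (A'.prodLeft hat).Modules) (h1 : HasRank P 1)
    (hker : ∀ (T : Over S') (u : T ⟶ A'.X), u ≫ π = 1 ↔ A'.MemKOfL L' u)
    (hrig : Nonempty ((Scheme.Modules.pullback (A'.unitSlice hat)).obj P ≅ SheafOfModules.unit _))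
    (hsock : Nonempty ((Scheme.Modules.pullback (A'.X ◁ π).left).obj P ≅ A'.mumfordBundle L'))
    (C' C : Type) [CommRing C'] [IsLocalRing C'] [CommRing C]
    (q : C' →+* C) (hq : Function.Surjective q) (t₀ : C') (hker₀ : RingHom.ker q = Ideal.span {t₀})
    (htm : ∀ m ∈ IsLocalRing.maximalIdeal C', t₀ * m = 0) (ht₀m : t₀ ∈ IsLocalRing.maximalIdeal C') (ht₀ : t₀ ≠ 0)
    (c' : Spec (.of C') ⟶ S')
    (ι₀ : Over.mk (Spec.map (CommRingCat.ofHom q) ≫ c') ⟶ Over.mk c') (hι : ι₀.left = Spec.map (CommRingCat.ofHom q))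
    [IsFirstOrderThickening (A'.X ◁ ι₀).left]
    (g : ℕ) (hg : (A'.baseChange (Spec.map (CommRingCat.ofHom (residue C')) ≫ c')).IsOfRelDim g)
    (E : (idealSheafAb (A'.X ◁ ι₀).left).H 1 ≃+ (Fin g → ResidueField C'))
    (hE : ∀ (c : C') (mu : idealSheafAb (A'.X ◁ ι₀).left ⟶ idealSheafAb (A'.X ◁ ι₀).left),
      (∀ (U : (A'.X ⊗ Over.mk c').left.Opens) (y : (idealSheafAb (A'.X ◁ ι₀).left).obj.obj (op U)),
        idealVal (A'.X ◁ ι₀).left U (mu.hom.app (op U) y) =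
          (A'.X ⊗ Over.mk c').left.presheaf.map (homOfLE le_top).op (specStructureMap (pullback.snd A'.X.hom c') c) *
            idealVal (A'.X ◁ ι₀).left U y) →
      ∀ t, E (Sheaf.H.map mu 1 t) = residue C' c • E t)
    (g₁ : Over.mk c' ⟶ hat.X) (t : (idealSheafAb (A'.X ◁ ι₀).left).H 1) :
    ∃ g₂ : Over.mk c' ⟶ hat.X, ι₀ ≫ g₂ = ι₀ ≫ g₁ ∧
      detClassH (HasRank.isFiniteLocallyFree' (hasRank_pullback _ h1 :
          HasRank (X := (A'.X ⊗ Over.mk c').left) ((Scheme.Modules.pullback (A'.baseChangeToProd hat c' g₂.left (Over.w g₂))).obj P) 1)) =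
        detClassH (HasRank.isFiniteLocallyFree' (hasRank_pullback _ h1 :
          HasRank (X := (A'.X ⊗ Over.mk c').left) ((Scheme.Modules.pullback (A'.baseChangeToProd hat c' g₁.left (Over.w g₁))).obj P) 1)) +
          Sheaf.H.map (truncExp (A'.X ◁ ι₀).left) 1 t := by
  haveI : Flat π.left := inferInstance
  -- the square for `𝒫` in the `Â`-variable (#2)
  have hsq : ∀ y₁ y₂ : Over.mk c' ⟶ hat.X,
      CechPic.pullback (A'.X ◁ (y₁ * y₂)).left (detClass (HasRank.isFiniteLocallyFree' h1)) =
        CechPic.pullback (A'.X ◁ y₁).left (detClass (HasRank.isFiniteLocallyFree' h1)) *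
          CechPic.pullback (A'.X ◁ y₂).left (detClass (HasRank.isFiniteLocallyFree' h1)) :=
    fun y₁ y₂ => A'.cechPic_pullback_whiskerLeft_mul_poincareClass hat π hL' hε' P h1 hrig hsock y₁ y₂
  -- the kernel of `q` is nilpotent (`t₀² = 0`)
  have hnil : IsNilpotent (RingHom.ker q) := by
    refine ⟨2, ?_⟩
    rw [hker₀, Ideal.span_singleton_pow, pow_two, htm t₀ ht₀m, Ideal.zero_eq_bot, Ideal.span_singleton_eq_bot]
  -- étale uniqueness of infinitesimal lifts (J1)
  have huniq : ∀ k : Over.mk c' ⟶ A'.X, ι₀ ≫ k = 1 → k ≫ π = 1 → k = 1 := fun k hk hkπ =>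
    Over.eq_of_etale_of_isNilpotent π q hq hnil c' ι₀ hι k 1 (hk.trans (MonObj.comp_one ι₀).symm)
      (hkπ.trans (MonObj.one_comp π).symm)
  -- the base ring `R₀ = Γ(S′, 𝒪)`, the structure algebra `R₀ → C′`, the unit `T`-point and a chart of relative dimension `g` around it
  letI : Algebra Γ(S', ⊤) C' := (Spec.preimage (c' ≫ S'.isoSpec.hom)).hom.toAlgebra
  have halg : Spec.map (CommRingCat.ofHom (algebraMap Γ(S', ⊤) C')) = c' ≫ S'.isoSpec.hom :=
    Spec.map_preimage (c' ≫ S'.isoSpec.hom)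
  have e1 : (1 : Over.mk c' ⟶ A'.X).left ≫ A'.X.hom = c' := Over.w _
  have w₁ : (1 : Over.mk c' ⟶ A'.X).left ≫ (A'.X.hom ≫ S'.isoSpec.hom) =
      Spec.map (CommRingCat.ofHom (algebraMap Γ(S', ⊤) C')) := by
    rw [halg, ← Category.assoc, e1]
  have hx₀ : A'.X.hom.base ((1 : Over.mk c' ⟶ A'.X).left.base (closedPoint C')) ∈
      Set.range (Spec.map (CommRingCat.ofHom (residue C')) ≫ c').base := by
    haveI : IsLocalHom (CommRingCat.ofHom (residue C')).hom := by
      show IsLocalHom (residue C')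
      infer_instance
    refine ⟨closedPoint (ResidueField C'), ?_⟩
    change (Spec.map (CommRingCat.ofHom (residue C')) ≫ c') (closedPoint (ResidueField C')) =
      ((1 : Over.mk c' ⟶ A'.X).left ≫ A'.X.hom) (closedPoint C')
    rw [e1, Scheme.Hom.comp_apply, Spec_closedPoint]
    rfl
  obtain ⟨V, hV, hxV, hVg⟩ := A'.exists_isStandardSmoothOfRelativeDimension_chart_of_isOfRelDim_baseChange
    (Spec.map (CommRingCat.ofHom (residue C')) ≫ c') hg _ hx₀
  have hg₁ : ((1 : Over.mk c' ⟶ A'.X).left : Spec (.of C') ⟶ A'.X.left) ⁻¹ᵁ V = ⊤ :=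
    Scheme.preimage_eq_top_of_closedPoint_mem ((1 : Over.mk c' ⟶ A'.X).left : Spec (.of C') ⟶ _) hxV
  -- the parametrisation of the infinitesimal `T`-points of `A′` by `κ^g` (p04)
  have H04 := exists_lifts_parametrisation (X := A'.X.left) (R₀ := Γ(S', ⊤)) (C' := C') (C := C) hV
    (A'.X.hom ≫ S'.isoSpec.hom) g hVg q hq t₀ ht₀ hker₀ htm ht₀m (1 : Over.mk c' ⟶ A'.X).left w₁ hg₁
  obtain ⟨pt, hptV, hrest⟩ := H04
  obtain ⟨hpt0, hrest⟩ := hrest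
  obtain ⟨hptw, hrest⟩ := hrest
  obtain ⟨hptred, hrest⟩ := hrest
  obtain ⟨_, hrest⟩ := hrest
  obtain ⟨hptinj, hrest⟩ := hrest
  obtain ⟨hptadd, hptsmul⟩ := hrest
  have wpt : ∀ v, pt v ≫ A'.X.hom = c' := fun v => by
    have h := hptw v
    rw [halg, ← Category.assoc] at h
    exact (cancel_mono S'.isoSpec.hom).1 h
  let ptO : (Fin g → ResidueField C') → (Over.mk c' ⟶ A'.X) := fun v => Over.homMk (pt v) (wpt v)
  have h1T₀ : (1 : Over.mk (Spec.map (CommRingCat.ofHom q) ≫ c') ⟶ A'.X) = ι₀ ≫ (1 : Over.mk c' ⟶ A'.X) :=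
    (MonObj.comp_one ι₀).symm
  have hιpt : ∀ v, ι₀ ≫ ptO v = ι₀ ≫ (1 : Over.mk c' ⟶ A'.X) := fun v => by
    refine Over.OverMorphism.ext ?_
    rw [Over.comp_left, Over.comp_left]
    change ι₀.left ≫ pt v = ι₀.left ≫ (1 : Over.mk c' ⟶ A'.X).left
    rw [hι]
    exact hptred v
  have hptO : ∀ v, ι₀ ≫ ptO v = 1 := fun v => (hιpt v).trans h1T₀.symm
  have hpt1 : ∀ v : Fin g → ResidueField C', ptO v = 1 → v = 0 := fun v heq =>
    hptinj v 0 ((congrArg Over.Hom.left heq).trans hpt0.symm)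
  -- a cocycle presenting `[Λ(L′)]`
  have hc0 : ∃ c : UnitCocycle (A'.X ⊗ A'.X).left, CechPic.mk c = A'.mumfordClass (detClass (HasRank.isFiniteLocallyFree' hL')) :=
    CechPic.mk_surjective _
  obtain ⟨c, hc⟩ := hc0
  refine A'.exists_lift_detClassH_eq_add_of_panels hat π hL' hε' P h1 hker hsock ι₀ hsq huniq E (residue C') residue_surjective
    ptO hptO hpt1 c hc (fun v w x₁ x₂ x₃ hx₁ hx₂ hx₃ => ?_) (fun a v x₁ x₂ hx₁ hx₂ => ?_) g₁ t
  · -- additivity (p03 over p04's chart relation)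
    exact Literature.AlgebraicGeometry.AbelianSchemes.Over.cechToH_whiskerLeft_eq_add_of_chart_sub_eq_add_sub A'.X
      (Over.mk (Spec.map (CommRingCat.ofHom q) ≫ c')) c' ι₀ (1 : Over.mk c' ⟶ A'.X) (ptO v) (ptO w) (ptO (v + w))
      (hιpt v) (hιpt w) (hιpt (v + w)) hV hg₁ (hptV v) (hptV w) (hptV (v + w)) (fun a => hptadd v w a) c x₁ x₂ x₃ hx₁ hx₂ hx₃
  · -- homogeneity (p03 over p04's chart relation, read through p05's scalar clause)
    obtain ⟨mu, hmu⟩ := exists_idealSheafAb_hom_mul_specStructureMap A'.X q c' ι₀ a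
    refine Eq.trans (congrArg E ?_) (hE a mu hmu _)
    exact Literature.AlgebraicGeometry.AbelianSchemes.Over.cechToH_whiskerLeft_eq_map_of_chart_sub_eq_mul_sub A'.X
      (Over.mk (Spec.map (CommRingCat.ofHom q) ≫ c')) c' ι₀ (1 : Over.mk c' ⟶ A'.X) (ptO v) (ptO (residue C' a • v))
      (hιpt v) (hιpt _) hV hg₁ (hptV v) (hptV _) a (fun a' => hptsmul a v a') c mu hmu x₁ x₂ hx₁ hx₂

/-- **S-e — KODAIRA–SPENCER SURJECTIVITY OF `𝒫′`, LIFT LEVEL**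
(letter `stub_F3McN3Se` of the (Mc) N3′ tower, verbatim): for a lift
`g₁ : Spec C′ → Â′` over `S′` and ANY class `t ∈ H¹(X′, 𝓘)` there is another lift `g₂` of the same `C`-point with
`[(1 × g₂)^*𝒫′] = [(1 × g₁)^*𝒫′] + H¹(truncExp)(t)`.  Assembled from B-p07 #3 §4 `exists_lift_detClassH_eq_add_of_count` (the count),
#2 (square for `𝒫`), K2 (classes of infinitesimal points), J1 (étale uniqueness), and the wave-1 panels p03 (additivity ∕ homogeneity of the
classes), p04 (parametrisation of infinitesimal points by `κ^g`), p05 (`H¹(𝓘) ≃ κ^g` with scalars); the trivial case `t₀ = 0` apart.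
[cite: MumfordAV1970, §13 (proof of the Theorem, pp. 125–130)] [cite: Hartshorne2010, §6 Thm. 6.4 (b) (pp. 50–51)] -/
theorem exists_lift_detClassH_eq_add_smallExtension :
    ∀ (R : Type) [CommRing R] [IsNoetherianRing R] [Algebra ℚ R] (A : AbelianSchemeOver (Spec (.of R)))
    (L : A.left.Modules) (hL : HasRank L 1)
    (_hε : CechPic.pullback A.unitSection (detClass (HasRank.isFiniteLocallyFree' hL)) = 1)
    (_hΘ : ∀ ⦃Ω : Type⦄ [Field Ω] [IsAlgClosed Ω] (s : Spec (.of Ω) ⟶ Spec (.of R)),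
      ∃ Θ : CartierDivisor (A.fibre s).toAbelianVariety.X.left, Θ.IsAmple ∧
        CechPic.pullback (X := (A.fibre s).toAbelianVariety.X.left) (pullback.fst A.X.hom s)
          (detClass (HasRank.isFiniteLocallyFree' hL)) = Θ.cechClass)
    {S' : Scheme.{0}} [IsAffine S'] (p : S' ⟶ Spec (.of R)) [IsFinite p] [Etale p] [Surjective p]
    (hat : AbelianSchemeOver S') (π : (A.baseChange p).X ⟶ hat.X) [IsMonHom π]
    (_hπ : IsFinite π.left ∧ Etale π.left ∧ Surjective π.left)
    (P : ((A.baseChange p).prodLeft hat).Modules)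
    (_hker : ∀ (T : Over S') (u : T ⟶ (A.baseChange p).X),
      u ≫ π = 1 ↔ (A.baseChange p).MemKOfL ((Scheme.Modules.pullback (pullback.fst A.X.hom p)).obj L) u)
    (_h1 : HasRank P 1)
    (_hrig : Nonempty ((Scheme.Modules.pullback ((A.baseChange p).unitSlice hat)).obj P ≅ SheafOfModules.unit _))
    (_hsock : Nonempty ((Scheme.Modules.pullback ((A.baseChange p).X ◁ π).left).obj P ≅
      (A.baseChange p).mumfordBundle ((Scheme.Modules.pullback (pullback.fst A.X.hom p)).obj L)))
    (C' C : Type) [CommRing C'] [IsLocalRing C'] [IsArtinianRing C'] [CommRing C] [IsLocalRing C] [IsArtinianRing C]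
    (q : C' →+* C) (_hq : Function.Surjective q) (t₀ : C') (_hker₀ : RingHom.ker q = Ideal.span {t₀})
    (_htm : ∀ m ∈ IsLocalRing.maximalIdeal C', t₀ * m = 0) (_ht₀m : t₀ ∈ IsLocalRing.maximalIdeal C')
    (c' : Spec (.of C') ⟶ S')
    (ι₀ : Over.mk (Spec.map (CommRingCat.ofHom q) ≫ c') ⟶ Over.mk c') (_hι : ι₀.left = Spec.map (CommRingCat.ofHom q))
    [IsFirstOrderThickening ((A.baseChange p).X ◁ ι₀).left]
    (g₁ : Over.mk c' ⟶ hat.X) (t : (idealSheafAb ((A.baseChange p).X ◁ ι₀).left).H 1),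
    ∃ g₂ : Over.mk c' ⟶ hat.X, ι₀ ≫ g₂ = ι₀ ≫ g₁ ∧
      detClassH (HasRank.isFiniteLocallyFree' (hasRank_pullback _ _h1 :
          HasRank (X := ((A.baseChange p).X ⊗ Over.mk c').left) ((Scheme.Modules.pullback ((A.baseChange p).baseChangeToProd hat c' g₂.left (Over.w g₂))).obj P) 1)) =
        detClassH (HasRank.isFiniteLocallyFree' (hasRank_pullback _ _h1 :
          HasRank (X := ((A.baseChange p).X ⊗ Over.mk c').left) ((Scheme.Modules.pullback ((A.baseChange p).baseChangeToProd hat c' g₁.left (Over.w g₁))).obj P) 1)) +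
          Sheaf.H.map (truncExp ((A.baseChange p).X ◁ ι₀).left) 1 t := by
  intro R _ _ _ A L hL hε hΘ S' _ p _ _ _ hat π _ hπ P hker h1 hrig hsock C' C _ _ _ _ _ _ q hq t₀ hker₀ htm ht₀m c' ι₀ hι _ g₁ t
  -- the line bundle `L′ = L|_{A′}` on `A′ := A ×_R S′`, rigidified along `ε`
  have hL' : HasRank (X := (A.baseChange p).left) ((Scheme.Modules.pullback (pullback.fst A.X.hom p)).obj L) 1 :=
    hasRank_pullback _ hL
  have hε' : CechPic.pullback (A.baseChange p).unitSection (detClass (HasRank.isFiniteLocallyFree' hL')) = 1 :=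
    A.cechPic_pullback_unitSection_baseChange_eq_one p hL hε
  -- instances on `π` and `S′`
  haveI : IsLocallyNoetherian S' := LocallyOfFiniteType.isLocallyNoetherian p
  haveI : IsFinite π.left := hπ.1
  haveI : Etale π.left := hπ.2.1
  haveI : Surjective π.left := hπ.2.2
  haveI : IsAffineHom π.left := inferInstance
  -- CASE `t₀ = 0`: the thickening is trivial, `H¹(𝓘) = 0`, `g₂ := g₁`
  by_cases ht₀ : t₀ = 0
  · subst ht₀
    have hqinj : Function.Injective q := by
      rw [RingHom.injective_iff_ker_eq_bot, hker₀, Ideal.span_singleton_eq_bot]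
    haveI : IsIso (CommRingCat.ofHom q) :=
      (ConcreteCategory.isIso_iff_bijective (CommRingCat.ofHom q)).mpr ⟨hqinj, hq⟩
    haveI : IsIso ι₀.left := by rw [hι]; infer_instance
    haveI : IsIso ((Over.forget S').map ι₀) := ‹IsIso ι₀.left›
    haveI : IsIso ι₀ := isIso_of_reflects_iso ι₀ (Over.forget S')
    haveI : IsIso ((A.baseChange p).X ◁ ι₀) := inferInstance
    haveI : IsIso ((A.baseChange p).X ◁ ι₀).left := inferInstance
    refine ⟨g₁, rfl, ?_⟩
    rw [sheafH_idealSheafAb_eq_zero_of_isIso ((A.baseChange p).X ◁ ι₀).left 1 t, map_zero, add_zero]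
  -- the relative dimension `g` of the closed fibre `A′_κ` and the target-space panel (p05)
  obtain ⟨g, hg⟩ := ((A.baseChange p).baseChange (Spec.map (CommRingCat.ofHom (residue C')) ≫ c')).exists_isOfRelDim
  obtain ⟨E, hE⟩ := exists_addEquiv_idealCohomology_pi_residueField_smallExtension R A p C' C q hq t₀ hker₀ htm ht₀ c' ι₀ hι g hg
  exact (A.baseChange p).exists_lift_detClassH_eq_add_of_principal hat π hL' hε' P h1 hker hrig hsock C' C q hq t₀ hker₀ htm ht₀m ht₀
    c' ι₀ hι g hg E hE g₁ t

end AbelianSchemeOver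

end Literature.AlgebraicGeometry.AbelianSchemes

end
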